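import Summits.QuantumFields.GaugeBoot.Rows.KZL2HD3HTab
import HarnessLib

/-!
# Gauge-boot: kernel check of the raw `H` class table of the kz-L2-H-3D problems, rows 286–392 (part 6/7)

Cell `pub-gaugeboot` (HOME `run/shared/lean/pub/pub-gaugeboot/`), seat lean1 (torus layer for rows C1–C2 (and C41–C50) = the certified
kz-L2-H-3D windows: label set, raw blocks, class/witness tables, the reduction identity, per-β bindings).

HONEST FRAMING (page 1 of every file of this cell): certified bounds on lattice expectations at STATED coupling,
gauge group, dimension and torus size; NOT a mass gap, NOT a continuum limit, NOT a string tension, NOT large `N`.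
The venture is explicitly NOT Yang–Mills-summit-bearing (barriers `FixedCouplingUltralocality`,
`PerturbativeInvisibility`).

`hcanon_rows_<lo>_<hi> : ∀ i, lo ≤ i < hi → ∀ j ≥ i, KZL2HD3.HCanonOK i j`, each range one closed computation (`decide +kernel`);
assembled in `KZL2HD3Canon`.
-/

noncomputable section

open Literature.MathematicalPhysics.QuantumFieldTheory

namespace Summit.QuantumFields.GaugeBoot

namespace KZL2HD3

set_option maxHeartbeats 0 in
/-- Rows `286 ≤ i < 304` of the `H` class table of the kz-L2-H-3D problems canonicalise (4653 entries; kernel). -/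
theorem hcanon_rows_286_304 : ∀ i : Fin 553, 286 ≤ i.val → i.val < 304 → ∀ j : Fin 553, i.val ≤ j.val → KZL2HD3.HCanonOK i j := by
  decide +kernel

set_option maxHeartbeats 0 in
/-- Rows `304 ≤ i < 323` of the `H` class table of the kz-L2-H-3D problems canonicalise (4560 entries; kernel). -/
theorem hcanon_rows_304_323 : ∀ i : Fin 553, 304 ≤ i.val → i.val < 323 → ∀ j : Fin 553, i.val ≤ j.val → KZL2HD3.HCanonOK i j := by
  decide +kernel

set_option maxHeartbeats 0 in
/-- Rows `323 ≤ i < 344` of the `H` class table of the kz-L2-H-3D problems canonicalise (4620 entries; kernel). -/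
theorem hcanon_rows_323_344 : ∀ i : Fin 553, 323 ≤ i.val → i.val < 344 → ∀ j : Fin 553, i.val ≤ j.val → KZL2HD3.HCanonOK i j := by
  decide +kernel

set_option maxHeartbeats 0 in
/-- Rows `344 ≤ i < 367` of the `H` class table of the kz-L2-H-3D problems canonicalise (4554 entries; kernel). -/
theorem hcanon_rows_344_367 : ∀ i : Fin 553, 344 ≤ i.val → i.val < 367 → ∀ j : Fin 553, i.val ≤ j.val → KZL2HD3.HCanonOK i j := by
  decide +kernel

set_option maxHeartbeats 0 in
/-- Rows `367 ≤ i < 393` of the `H` class table of the kz-L2-H-3D problems canonicalise (4511 entries; kernel). -/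
theorem hcanon_rows_367_393 : ∀ i : Fin 553, 367 ≤ i.val → i.val < 393 → ∀ j : Fin 553, i.val ≤ j.val → KZL2HD3.HCanonOK i j := by
  decide +kernel

end KZL2HD3

end Summit.QuantumFields.GaugeBoot

end
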